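import Summits.QuantumFields.YangMills.Theorems.AllWindowsColdBoxBoxHighLineOrbitJacobianDefs
import Summits.QuantumFields.YangMills.Theorems.AllWindowsColdBoxBoxHighLinePauliFarRegion

/-!
# T-S5.4J glue «J0»: the Jacobian-weighted smeared weight `jacWeight` meets the hypotheses of the smeared Faddeev–Popov identity (✓T-S5.1)

Untabled glue of step (1b-J) (planner ym-idea-2 g18's `Cruxes/BoxWindowHighSU2213/TaskS5Laplace.lean`, ae884a356928; builder fcl-p3 g25's
✓`…OrbitJacobianDefs` carries `jacWeight β H r W = fpWeight β H r W · |det (fpOperator H W)|` verbatim), for the XL comparison stub S5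
(LINE-19 ⟨stmt-QuantumFields-24004⟩/⟨24335⟩; U5 = LINE-20 ⟨24336⟩).  The task docstring says: «Measurable, `≥ 0`, bounded (J5b), so ✓T-S5.1 applies
to `h_J + ε`» — this file proves exactly that:

* `continuous_fpOperator_apply`, **`continuous_fpOperator_det`** — the entries of `fpOperator H W` are polynomial in the links
  (✓`fpOperator_apply`, ✓`divDefectLin_apply`, `pauliLinkLin = X·W_e − W_e·X'`), so `W ↦ det (fpOperator H W)` is continuous (Mathlib
  `Continuous.matrix_det`); hence `continuous_jacWeight`, `measurable_jacWeight`;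
* `jacWeight_le` — `jacWeight β H r W ≤ exp(18·n'·(1 + log n'))` for `β ≥ 0` (✓`fpWeight_le_one` × ✓J5b `fpDetCrude`);
* `orbitAverage_jacWeight_floor_pos` — `0 < N_{h_J + ε}` for `ε > 0` (✓`orbitAverage_add_const_pos`);
* **`integral_mul_jacWeight_floor_div_orbitAverage_eq`** — ✓`smearedFPIdentity` instantiated at `h := jacWeight β H r + ε`:
  `∫ F · (h_J + ε)/N_{h_J+ε} ∂boxState = ∫ F ∂boxState` for every interior-gauge-invariant integrable `F` (the FP representation the T-S5.4J assembly
  starts from; pattern of w2 g30's ✓`integral_mul_fpWeight_floor_div_orbitAverage_eq`).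

Tree (✓…OrbitJacobianDefs, ✓…PauliFarRegion) + Mathlib; no definitions; standard axioms.  HONEST LABEL: glue of step (1b-J) of the XL stub S5; T-S5.4J,
S5, U5 and the cruxes ⟨24004⟩ ⟨24335⟩ ⟨24336⟩ remain OPEN; no summit is proved; the Yang–Mills mass gap is NOT proved by this file.  Seat
ym-line-sfw-p2-w5 g21 (cell ym-idea-1).
-/

set_option autoImplicit false

noncomputable section

open MeasureTheory
open Literature.MathematicalPhysics.QuantumFieldTheory.Balaban1983to89.B10Eq18SigmaSU2 (su2Coord)
open Literature.MathematicalPhysics.QuantumLattice (gaugeTransformZd LGConfig ZdEdge fundamentalRep)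
open Literature.Probability.LatticeModels (Site)
open Summit.QuantumFields.YangMills.Theorems.WeakCouplingRates (boxState)

namespace Summit.QuantumFields.YangMills.Theorems.AllWindowsColdBoxBoxHighLine

namespace JacWeight

/-- The link matrix `W_e ∈ M₂(ℂ)` depends continuously on the configuration. -/
theorem continuous_coe_apply (e : ZdEdge 4) : Continuous fun W : LGConfig 4 SU2 => ((W e : SU2) : Matrix (Fin 2) (Fin 2) ℂ) :=
  continuous_subtype_val.comp (continuous_apply e)

/-- `W ↦ pauliLinkLin W a e` is continuous (fixed field `a`, fixed edge `e`). -/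
theorem continuous_pauliLinkLin (a : Site 4 → EuclideanSpace ℝ (Fin 3)) (e : ZdEdge 4) :
    Continuous fun W : LGConfig 4 SU2 => pauliLinkLin W a e := by
  unfold pauliLinkLin
  exact (continuous_const.mul (continuous_coe_apply e)).sub ((continuous_coe_apply e).mul continuous_const)

/-- Components of `imVecM` of a continuously varying matrix are continuous. -/
theorem continuous_imVecM_comp {X : LGConfig 4 SU2 → Matrix (Fin 2) (Fin 2) ℂ} (hX : Continuous X) (c : Fin 3) :
    Continuous fun W => imVecM (X W) c := by
  have hent : ∀ i j : Fin 2, Continuous fun W => X W i j := fun i j => (continuous_apply j).comp ((continuous_apply i).comp hX)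
  fin_cases c
  · exact Complex.continuous_im.comp (hent 0 0)
  · exact Complex.continuous_re.comp (hent 1 0)
  · exact Complex.continuous_im.comp (hent 1 0)

/-- `W ↦ divDefectLin W a x c` is continuous. -/
theorem continuous_divDefectLin (a : Site 4 → EuclideanSpace ℝ (Fin 3)) (x : Site 4) (c : Fin 3) :
    Continuous fun W : LGConfig 4 SU2 => divDefectLin W a x c := by
  simp only [divDefectLin_apply]
  exact continuous_finsetSum _ fun μ _ =>
    (continuous_imVecM_comp (continuous_pauliLinkLin a _) c).sub (continuous_imVecM_comp (continuous_pauliLinkLin a _) c)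

end JacWeight

open JacWeight

/-- **The entries of the Faddeev–Popov operator depend continuously on the configuration.** -/
theorem continuous_fpOperator_apply (H : ℕ) (p q : ↥(interiorSites H) × Fin 3) : Continuous fun W : LGConfig 4 SU2 => fpOperator H W p q := by
  simp only [fpOperator_apply]
  exact continuous_divDefectLin _ _ _

/-- **`W ↦ det (fpOperator H W)` is continuous.** -/
theorem continuous_fpOperator_det (H : ℕ) : Continuous fun W : LGConfig 4 SU2 => (fpOperator H W).det :=
  (continuous_matrix fun p q => continuous_fpOperator_apply H p q).matrix_det

/-- `h_J` is continuous. -/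
theorem continuous_jacWeight (β : ℝ) (H : ℕ) (r : ℝ) : Continuous (jacWeight β H r) := by
  unfold jacWeight
  exact (continuous_fpWeight β H r).mul (continuous_fpOperator_det H).abs

/-- `h_J` is measurable. -/
theorem measurable_jacWeight (β : ℝ) (H : ℕ) (r : ℝ) : Measurable (jacWeight β H r) := by
  haveI : SecondCountableTopology SU2 := inferInstance
  exact (continuous_jacWeight β H r).measurable

/-- The floored Jacobian weight is measurable. -/
theorem measurable_jacWeight_add_const (β : ℝ) (H : ℕ) (r ε : ℝ) : Measurable fun W => jacWeight β H r W + ε :=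
  (measurable_jacWeight β H r).add_const ε

/-- **`h_J` is bounded**: `jacWeight β H r W ≤ exp(C·n'·(1 + log n'))` with J5b's constant (`β ≥ 0`). -/
theorem jacWeight_le {β : ℝ} (hβ : 0 ≤ β) (H : ℕ) (r : ℝ) :
    ∃ C : ℝ, 0 < C ∧ ∀ W : LGConfig 4 SU2,
      jacWeight β H r W ≤ Real.exp (C * (interiorSites H).card * (1 + Real.log ((interiorSites H).card))) := by
  obtain ⟨C, hC, hdet⟩ := fpDetCrude
  refine ⟨C, hC, fun W => ?_⟩
  unfold jacWeight
  calc fpWeight β H r W * |(fpOperator H W).det| ≤ 1 * Real.exp (C * (interiorSites H).card * (1 + Real.log ((interiorSites H).card))) :=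
        mul_le_mul (fpWeight_le_one hβ H r W) (hdet H W) (abs_nonneg _) zero_le_one
    _ = _ := one_mul _

/-- The floored Jacobian weight is nonnegative for `ε ≥ 0`. -/
theorem jacWeight_add_const_nonneg (β : ℝ) (H : ℕ) (r : ℝ) {ε : ℝ} (hε : 0 ≤ ε) (W : LGConfig 4 SU2) : 0 ≤ jacWeight β H r W + ε :=
  add_nonneg (jacWeight_nonneg β H r W) hε

/-- **The floored Jacobian weight has everywhere-positive orbit average** (`≥ ε`): the hypothesis `0 < orbitAverage` of ✓`SmearedFPIdentity`. -/
theorem orbitAverage_jacWeight_floor_pos (β : ℝ) (H : ℕ) (r : ℝ) {ε : ℝ} (hε : 0 < ε) (U : LGConfig 4 SU2) :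
    0 < orbitAverage H (fun V => jacWeight β H r V + ε) U :=
  orbitAverage_add_const_pos (continuous_jacWeight β H r) (jacWeight_nonneg β H r) hε U

/-- The floored orbit average is at least `ε`. -/
theorem le_orbitAverage_jacWeight_floor (β : ℝ) (H : ℕ) (r ε : ℝ) (U : LGConfig 4 SU2) :
    ε ≤ orbitAverage H (fun V => jacWeight β H r V + ε) U := by
  rw [orbitAverage_add_const (continuous_jacWeight β H r) ε U]
  linarith [orbitAverage_nonneg (H := H) (jacWeight_nonneg β H r) U]

/-- **The smeared Faddeev–Popov identity for the floored JACOBIAN weight** `h = h_J + ε` (`βw ≥ 0`, `ε > 0`): for every interior-gauge-invariant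
integrable `F`, `∫ F · (h_J + ε)/N_{h_J + ε} ∂boxState = ∫ F ∂boxState` (✓`smearedFPIdentity` + this file). -/
theorem integral_mul_jacWeight_floor_div_orbitAverage_eq (β : ℝ) (H : ℕ) {βw : ℝ} (hβw : 0 ≤ βw) (r : ℝ) {ε : ℝ} (hε : 0 < ε)
    {F : LGConfig 4 SU2 → ℝ} (hF : ∀ g : InteriorGauge H, ∀ U, F (gaugeTransformZd (extendGauge H g) U) = F U)
    (hFi : Integrable F (boxState (fundamentalRep (Fin 2)) β H)) :
    ∫ U, F U * ((jacWeight βw H r U + ε) / orbitAverage H (fun V => jacWeight βw H r V + ε) U) ∂(boxState (fundamentalRep (Fin 2)) β H) =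
      ∫ U, F U ∂(boxState (fundamentalRep (Fin 2)) β H) := by
  obtain ⟨C, _, hle⟩ := jacWeight_le hβw H r
  exact smearedFPIdentity β H F (fun V => jacWeight βw H r V + ε) hF hFi (measurable_jacWeight_add_const βw H r ε)
    (jacWeight_add_const_nonneg βw H r hε.le)
    ⟨Real.exp (C * (interiorSites H).card * (1 + Real.log ((interiorSites H).card))) + ε, fun U => by linarith [hle U]⟩
    (orbitAverage_jacWeight_floor_pos βw H r hε)

end Summit.QuantumFields.YangMills.Theorems.AllWindowsColdBoxBoxHighLine

end
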